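import Literature.AlgebraicTopology.SingularHomology.MayerVietorisFiniteness
import Literature.AlgebraicTopology.SingularHomology.DisjointUnion
import Mathlib.LinearAlgebra.Dimension.RankNullity
import Mathlib.LinearAlgebra.Dimension.Localization
import Mathlib.LinearAlgebra.FreeModule.Finite.Basic
import HarnessLib

/-!
# The first Betti number from a Mayer–Vietoris cover with homologically discrete pieces

Topic `Literature/AlgebraicTopology/SingularHomology`; written for the fact seat
`provefact-Literature.Topology.FourManifolds.sliceGenus_torusKnot` (the first Betti number of the
affine Milnor fibre `{U^q - V^p = 1}`, Milnor 1968, Thm. 9.1, via the cover by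
`{Re U^q < 2/3}` and `{Re U^q > 1/3}`).  Everything here is **proved**; no named fact is introduced.

A. Hatcher, *Algebraic Topology* (2002), §2.2, pp. 149–150: for an open cover `X = A ∪ B` the
Mayer–Vietoris sequence ends
`H₁(A) ⊕ H₁(B) → H₁(X) →∂ H₀(A ∩ B) →φ H₀(A) ⊕ H₀(B) →ψ H₀(X) → 0`.
If `H₁(A) = H₁(B) = 0`, `H₀(A) ≅ ℤᵃ`, `H₀(B) ≅ ℤᵇ`, `H₀(A ∩ B) ≅ ℤᶜ` and `X` is path connected,
then `∂` is injective and counting ranks along the exact sequence (rank–nullity over `ℤ`,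
Mathlib's `HasRankNullity`) gives **`rank H₁(X; ℤ) = c - a - b + 1`** and `H₁(X; ℤ)` finitely
generated (`mayerVietoris_finrank_one`; e.g. Hatcher, Example 2.46-style computations, or the
Euler characteristic count `χ = V - E` for the nerve).  The inputs for pieces that are homotopy
equivalent to finite discrete spaces are supplied by:

* `singularHomology.zeroLinearEquivOfPathConnected` — `H₀(X; M) ≃ₗ[R] M` for `X` path connected
  (Hatcher Prop. 2.7, the tree's augmentation iso `singularHomology.isIso_ε_of_pathConnectedSpace`);
* `singularHomology.nonempty_zeroLinearEquivFin` — `H₀(Fin m; M) ≃ₗ[R] (Fin m → M)` for `m ≥ 1`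
  (Hatcher Prop. 2.6/2.7; induction on `m` with the tree's additivity `singularHomology.sumEquiv`);
* `singularHomology.isZero_fin` — `Hₙ(Fin m; M) = 0` for `n ≠ 0` (Prop. 2.8).

## References

* A. Hatcher, *Algebraic Topology*, CUP 2002, §2.1 Prop. 2.6–2.8, §2.2 pp. 149–150.
  [HatcherAT2002]
-/

noncomputable section

open CategoryTheory Limits Set Function Topology

universe u v

namespace Literature.AlgebraicTopology.SingularHomology

variable (R : Type v) [CommRing R] (M : Type v) [AddCommGroup M] [Module R M]

namespace singularHomology

/-! ### Finite discrete spaces, path-connected spaces -/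

/-- **`H₀(X; M) ≃ₗ[R] M` for a path-connected space** (Hatcher 2002, Prop. 2.7: the augmentation
`ε` is an isomorphism). [cite: HatcherAT2002, Prop. 2.7] -/
def zeroLinearEquivOfPathConnected (X : Type u) [TopologicalSpace X] [PathConnectedSpace X] :
    singularHomology R M X 0 ≃ₗ[R] M :=
  haveI := isIso_ε_of_pathConnectedSpace R M (X := X)
  (asIso (ε R M X)).toLinearEquiv ≪≫ₗ ULift.moduleEquiv

/-- **`Hₙ(Fin m; M) = 0` for `n ≠ 0`** (a finite discrete space is totally disconnected;
Hatcher 2002, Prop. 2.8 with Prop. 2.6). [cite: HatcherAT2002, Prop. 2.8] -/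
theorem isZero_fin (m : ℕ) {n : ℕ} (hn : n ≠ 0) : IsZero (singularHomology R M (Fin m) n) :=
  isZero_singularHomology_of_totallyDisconnectedSpace R M hn

/-- `Fin (m + 1) ≃ₜ Fin m ⊕ Unit` (discrete spaces). [folklore] -/
def finSuccHomeomorph (m : ℕ) : Fin (m + 1) ≃ₜ (Fin m ⊕ Unit) where
  toEquiv := finSumFinEquiv.symm.trans (Equiv.sumCongr (Equiv.refl (Fin m)) (Equiv.ofUnique (Fin 1) Unit))
  continuous_toFun := continuous_of_discreteTopology
  continuous_invFun := continuous_of_discreteTopology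

/-- `(Fin m → M) × M ≃ₗ[R] (Fin (m + 1) → M)`. [folklore] -/
def finSuccArrowEquiv (m : ℕ) : ((Fin m → M) × M) ≃ₗ[R] (Fin (m + 1) → M) :=
  (LinearEquiv.prodCongr (LinearEquiv.refl R (Fin m → M)) (LinearEquiv.funUnique Unit R M).symm) ≪≫ₗ
    (LinearEquiv.sumArrowLequivProdArrow (Fin m) Unit R M).symm ≪≫ₗ
      LinearEquiv.funCongrLeft R M (finSuccHomeomorph m).toEquiv

/-- **`H₀(Fin (m + 1); M) ≃ₗ[R] Mᵐ⁺¹`** (Hatcher 2002, Prop. 2.6 and 2.7: `H₀` of a disjoint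
union of finitely many points), by induction on `m` with additivity `singularHomology.sumEquiv`;
the base case `Fin 1` is a point. [cite: HatcherAT2002, Prop. 2.6 and Prop. 2.7] -/
theorem nonempty_zeroLinearEquivFin :
    ∀ m : ℕ, Nonempty (singularHomology R M (Fin (m + 1)) 0 ≃ₗ[R] (Fin (m + 1) → M))
  | 0 => ⟨zeroLinearEquivOfPathConnected R M (Fin 1) ≪≫ₗ (LinearEquiv.funUnique (Fin 1) R M).symm⟩
  | m + 1 => by
    obtain ⟨e⟩ := nonempty_zeroLinearEquivFin m
    have e₁ : singularHomology R M (Fin (m + 2)) 0 ≃ₗ[R] singularHomology R M (Fin (m + 1) ⊕ Unit) 0 :=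
      (mapIso R M (finSuccHomeomorph (m + 1)) 0).toLinearEquiv
    have e₂ : singularHomology R M (Fin (m + 1) ⊕ Unit) 0 ≃ₗ[R]
        (singularHomology R M (Fin (m + 1)) 0 × singularHomology R M Unit 0) :=
      (sumEquiv R M (Fin (m + 1)) Unit 0).symm
    have e₃ : (singularHomology R M (Fin (m + 1)) 0 × singularHomology R M Unit 0) ≃ₗ[R]
        ((Fin (m + 1) → M) × M) :=
      LinearEquiv.prodCongr e (zeroLinearEquivOfPathConnected R M Unit)
    exact ⟨e₁ ≪≫ₗ e₂ ≪≫ₗ e₃ ≪≫ₗ finSuccArrowEquiv R M (m + 1)⟩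

/-- `H₀(Fin m; M) ≃ₗ[R] Mᵐ` for `m ≠ 0`. [cite: HatcherAT2002, Prop. 2.6 and Prop. 2.7] -/
theorem nonempty_zeroLinearEquivFin_of_ne_zero {m : ℕ} (hm : m ≠ 0) :
    Nonempty (singularHomology R M (Fin m) 0 ≃ₗ[R] (Fin m → M)) := by
  obtain ⟨k, rfl⟩ := Nat.exists_eq_succ_of_ne_zero hm
  exact nonempty_zeroLinearEquivFin R M k

end singularHomology

/-! ### Rank bookkeeping over `ℤ` -/

section RankNullity

variable {S : Type*} [CommRing S] [IsDomain S] [IsNoetherianRing S] {P Q : Type*} [AddCommGroup P]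
  [Module S P] [AddCommGroup Q] [Module S Q]

/-- Rank–nullity over a commutative domain with `finrank`: `rank (range f) + rank (ker f) = rank P`
for `P` finitely generated (Mathlib's `HasRankNullity`, in the quotient-free form
`LinearMap.lift_rank_range_add_rank_ker`). [folklore] -/
theorem finrank_range_add_finrank_ker_of_isDomain [Module.Finite S P] (f : P →ₗ[S] Q) :
    Module.finrank S (LinearMap.range f) + Module.finrank S (LinearMap.ker f) = Module.finrank S P := by
  have h := LinearMap.lift_rank_range_add_rank_ker f
  rw [← Module.finrank_eq_rank, ← Module.finrank_eq_rank, ← Module.finrank_eq_rank] at h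
  simp only [Cardinal.lift_natCast] at h
  exact_mod_cast h

end RankNullity

/-! ### The first Betti number from the end of the Mayer–Vietoris sequence -/

section BettiOne

variable {X : Type u} [TopologicalSpace X]

/-- A morphism out of a biproduct of zero objects is zero. [folklore] -/
theorem biprod_desc_eq_zero_of_isZero {C : Type*} [Category C] [HasZeroMorphisms C]
    [HasBinaryBiproducts C] {A B D : C} (hA : IsZero A) (hB : IsZero B) (f : A ⊞ B ⟶ D) : f = 0 :=
  biprod.hom_ext' _ _ (hA.eq_of_src _ _) (hB.eq_of_src _ _)

variable {S : Type v} [CommRing S] [IsDomain S] [IsNoetherianRing S]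

/-- **The first Betti number from a Mayer–Vietoris cover with homologically discrete pieces.**
Let `X = U ∪ V` with `U`, `V` open, `X` path connected, and coefficients in a Noetherian domain
`S` (e.g. `ℤ`): if `H₁(U; S) = H₁(V; S) = 0`, `H₀(U) ≅ Sᵃ`, `H₀(V) ≅ Sᵇ`, `H₀(U ∩ V) ≅ Sᶜ`, then
`H₁(X; S)` is finitely generated and `rank H₁(X; S) + a + b = c + 1`.  Proof: in
`H₁(U) ⊕ H₁(V) →ψ₁ H₁(X) →∂ H₀(U ∩ V) →φ H₀(U) ⊕ H₀(V) →ψ H₀(X) → 0` (Hatcher 2002, §2.2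
pp. 149–150; the tree's `mayerVietoris.exact₁/₂/₃_holds`, `ψ_surjective_zero`) `ψ₁ = 0`, so `∂`
is injective and `rank H₁(X) = rank ker φ`; rank–nullity for `φ` and `ψ` with
`range φ = ker ψ`, `range ψ = H₀(X) ≅ S`. [cite: HatcherAT2002, §2.2 pp. 149–150] -/
theorem mayerVietoris_finrank_one [PathConnectedSpace X] (U V : Set X) (hU : IsOpen U)
    (hV : IsOpen V) (hUV : U ∪ V = univ)
    (hU₁ : IsZero (singularHomology S S U 1)) (hV₁ : IsZero (singularHomology S S V 1))
    {a b c : ℕ} (eU : singularHomology S S U 0 ≃ₗ[S] (Fin a → S))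
    (eV : singularHomology S S V 0 ≃ₗ[S] (Fin b → S))
    (eW : singularHomology S S ↥(U ∩ V) 0 ≃ₗ[S] (Fin c → S)) :
    Module.finrank S (singularHomology S S X 1) + (a + b) = c + 1 ∧
      Module.Finite S (singularHomology S S X 1) := by
  have h : interior U ∪ interior V = univ := by rw [hU.interior_eq, hV.interior_eq, hUV]
  have hexc := relativeSingularHomology.isIso_map_of_interior_union_interior_holds S S X
  -- the maps
  set δ := mayerVietoris.δ S S U V hexc h 0 with hδ
  set φ := mayerVietoris.φ S S U V 0 with hφ
  set ψ := mayerVietoris.ψ S S U V 0 with hψ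
  -- `∂` is injective
  have hψ₁ : mayerVietoris.ψ S S U V 1 = 0 := biprod_desc_eq_zero_of_isZero hU₁ hV₁ _
  have hmono : Mono δ := (mayerVietoris.exact₂_holds S S U V hexc h 0).mono_g hψ₁
  have hinj : Injective δ.hom := (ModuleCat.mono_iff_injective δ).1 hmono
  -- exactness as equalities of submodules
  have h₃ : LinearMap.range δ.hom = LinearMap.ker φ.hom :=
    (mayerVietoris.exact₃_holds S S U V hexc h 0).moduleCat_range_eq_ker
  have h₁ : LinearMap.range φ.hom = LinearMap.ker ψ.hom :=
    (mayerVietoris.exact₁_holds S S U V h 0).moduleCat_range_eq_ker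
  have hsurj : LinearMap.range ψ.hom = ⊤ :=
    LinearMap.range_eq_top.2 (mayerVietoris.ψ_surjective_zero S S U V hexc h)
  -- finiteness and ranks of the `H₀`'s
  have eUV : (singularHomology S S U 0 ⊞ singularHomology S S V 0 : ModuleCat S) ≃ₗ[S]
      ((Fin a → S) × (Fin b → S)) :=
    (ModuleCat.biprodIsoProd _ _).toLinearEquiv ≪≫ₗ LinearEquiv.prodCongr eU eV
  haveI hfinW : Module.Finite S (singularHomology S S ↥(U ∩ V) 0) := Module.Finite.equiv eW.symm
  haveI hfinUV : Module.Finite S (singularHomology S S U 0 ⊞ singularHomology S S V 0 : ModuleCat S) :=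
    Module.Finite.equiv eUV.symm
  have hrkW : Module.finrank S (singularHomology S S ↥(U ∩ V) 0) = c := by
    rw [LinearEquiv.finrank_eq eW, Module.finrank_fin_fun]
  have hrkUV : Module.finrank S (singularHomology S S U 0 ⊞ singularHomology S S V 0 : ModuleCat S) = a + b := by
    rw [LinearEquiv.finrank_eq eUV, Module.finrank_prod, Module.finrank_fin_fun, Module.finrank_fin_fun]
  have hrkX : Module.finrank S (singularHomology S S X 0) = 1 := by
    rw [LinearEquiv.finrank_eq (singularHomology.zeroLinearEquivOfPathConnected S S X), Module.finrank_self]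
  -- rank–nullity for `φ` and `ψ`
  have rnφ := finrank_range_add_finrank_ker_of_isDomain φ.hom
  have rnψ := finrank_range_add_finrank_ker_of_isDomain ψ.hom
  -- `rank (range ψ) = rank H₀(X) = 1`
  have e4 : Module.finrank S (LinearMap.range ψ.hom) = 1 := by
    rw [LinearEquiv.finrank_eq (LinearEquiv.ofTop (LinearMap.range ψ.hom) hsurj), hrkX]
  rw [hrkUV, e4] at rnψ
  -- `rank H₁(X) = rank (range ∂) = rank (ker φ)`
  have e3 : Module.finrank S (LinearMap.ker φ.hom) = Module.finrank S (singularHomology S S X 1) := by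
    rw [← h₃]
    exact LinearMap.finrank_range_of_inj hinj
  rw [hrkW, h₁, e3] at rnφ
  refine ⟨by omega, ?_⟩
  exact Module.Finite.of_injective δ.hom hinj

end BettiOne

end Literature.AlgebraicTopology.SingularHomology
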